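import Summits.Ventures.PercRepro.Night2LocalD3ThreeOneB

/-!
# PercRepro — the cell `(a, k) = (2, 1)` at `|E ∖ G| = 3`, `q = 4`: structure (night-2, gen 13)

`M|G` has one coloop `K = {y}`; at a far set `S` with two coloops, `coloops S = K ∪ {x}` (`exists_coloops_eq_insert_one`).

* a nonzero loss needs THREE layer-1 preimages at one coloop (`7/10 ≤ capS < L₁ ≤ #·(6/25)`), hence `≥ 4` coloops of the covering
  set and `|S| = 6` (`card_eq_six_of_mem_ex2_one`);
* the members carrying weight are the pair members `S ∖ P` (`P` a pair of non-coloops); both points of the pair lie outside the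
  closure (`not_mem_clF_of_pair'`), so `|G ∖ cl B| ≥ 2` and `≥ 3` unless `B` is fat (`G ∖ S ⊆ cl B`) (`req_pair_le'`).
-/

open scoped Matroid

namespace PercRepro.Shadow

open Finset PerFlat ThmH

variable {α : Type*} [DecidableEq α] {M : Matroid α} [M.Finite]

section TwoOneA

variable {G S : Finset α}

open scoped Classical in
/-- **A nonzero loss needs three layer-1 preimages** at `|E ∖ G| = 3`, `kColoops = 1`: `7/10 ≤ capS < L₁ ≤ #·(6/25)`. -/
theorem three_le_card_nonLay0_of_loss_ne_zero (hG : G ∈ flatsQ M (4 + 1)) (hd : (gr M \ G).card = 3)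
    (hk : kColoops M G = 1) {B : Finset α} {z : α} (hzG : z ∈ G) (hBG : B ⊆ G) (hloss : loss M 4 G B z ≠ 0) :
    3 ≤ ((coverPreimages M (Uq M (4 + 2) 4) G (insert z B)).filter (fun B => B ∉ lay0 M 4 G)).card := by
  have hcap : 7 / 10 ≤ capS M 4 G (insert z B) := seven_tenths_le_capS hd hk (Finset.insert_subset hzG hBG)
  have hL : capS M 4 G (insert z B) < L1 M 4 G (insert z B) := by
    by_contra hle
    push Not at hle
    apply hloss
    unfold loss fS
    rw [if_pos hle]
    simp
  have hL1 := L1_le_card_mul hG hd (by norm_num) (insert z B)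
  rw [phiQ_four_div_five] at hL1
  by_contra hlt
  push Not at hlt
  have : (((coverPreimages M (Uq M (4 + 2) 4) G (insert z B)).filter (fun B => B ∉ lay0 M 4 G)).card : ℚ) ≤ 2 := by
    exact_mod_cast Nat.lt_succ_iff.1 hlt
  linarith

open scoped Classical in
/-- **A covering set carrying a loss has five elements** at one coloop of `M|G`. -/
theorem card_eq_five_of_loss_ne_zero_one (hs : ∀ e ∈ gr M, ∀ f ∈ gr M, e ≠ f → rkN M {e, f} = 2)
    (hl : ∀ e ∈ gr M, M.Indep {e}) (hG : G ∈ flatsQ M (4 + 1)) (hd : (gr M \ G).card = 3) (hk : kColoops M G = 1)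
    {B : Finset α} (hBm : B ∈ membersIn M (Uq M (4 + 2) 4) G) {z : α} (hz : z ∈ G \ clF M B)
    (hloss : loss M 4 G B z ≠ 0) : (insert z B).card = 5 := by
  have hGg : G ⊆ gr M := (mem_flatsQ.1 hG).1
  have hBU : B ∈ Uq M (4 + 2) 4 := (mem_membersIn.1 hBm).1
  have hBG : B ⊆ G := (subset_clF hBU).trans (mem_membersIn.1 hBm).2
  have hS'' : insert z B ∈ shadowAt M (4 + 2) 4 (Uq M (4 + 2) 4) G :=
    insert_mem_shadowAt (Finset.Subset.refl _) hG hBm hz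
  have hSg : insert z B ⊆ gr M := (subset_of_mem_shadowAt hS'').trans hGg
  have h2 := three_le_card_nonLay0_of_loss_ne_zero hG hd hk (Finset.mem_sdiff.1 hz).1 hBG hloss
  have h3 := card_nonLay0_preimages_le hG hd hS''
  have hKsub : G.filter (fun y => y ∉ clF M (G.erase y)) ⊆ coloops M (insert z B) := coloopsG_subset_coloops hS''
  have hKc : (G.filter (fun y => y ∉ clF M (G.erase y))).card = 1 := hk
  have h4 : 4 ≤ (coloops M (insert z B)).card := by
    have := Finset.card_sdiff_add_card_eq_card hKsub
    omega
  have hr := rkN_nonColoops_add hSg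
  rw [rkN_eq_of_mem_shadowAt hS''] at hr
  have hN1 : rkN M (nonColoops M (insert z B)) ≤ 1 := by omega
  have hNc : (nonColoops M (insert z B)).card ≤ 1 := by
    apply card_le_one_of_eRk_le_one hs (Finset.sdiff_subset.trans hSg)
    rw [eRk_eq_rkN]
    exact_mod_cast hN1
  have hsplit := Finset.card_sdiff_add_card_eq_card (coloops_subset_self (M := M) (insert z B))
  have hcol5 : (coloops M (insert z B)).card ≤ 5 :=
    card_coloops_le hSg (u := 5) (by rw [eRk_eq_rkN, rkN_eq_of_mem_shadowAt hS''])
  by_cases hN : (nonColoops M (insert z B)).card = 0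
  · have hN' : rkN M (nonColoops M (insert z B)) = 0 := by
      rw [Finset.card_eq_zero] at hN
      rw [hN]; unfold rkN; simp
    unfold nonColoops at hsplit hN
    omega
  · have hN1' : (nonColoops M (insert z B)).card = 1 := by omega
    have hrN : rkN M (nonColoops M (insert z B)) = 1 := by
      obtain ⟨e, he⟩ := Finset.card_eq_one.1 hN1'
      have heN : e ∈ nonColoops M (insert z B) := by rw [he]; exact Finset.mem_singleton_self e
      have heg : e ∈ gr M := hSg (mem_nonColoops.1 heN).1
      rw [he, rkN_eq_card_of_indep (by rw [Finset.coe_singleton]; exact hl e heg), Finset.card_singleton]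
    unfold nonColoops at hsplit hN1'
    omega

open scoped Classical in
/-- **Every far set with a member carrying layer-2 weight has six elements** (one coloop of `M|G`). -/
theorem card_eq_six_of_mem_ex2_one (hs : ∀ e ∈ gr M, ∀ f ∈ gr M, e ≠ f → rkN M {e, f} = 2)
    (hl : ∀ e ∈ gr M, M.Indep {e}) (hG : G ∈ flatsQ M (4 + 1)) (hd : (gr M \ G).card = 3) (hk : kColoops M G = 1)
    {B : Finset α} (hB : B ∈ ex2 M 4 G S) : S.card = 6 := by
  obtain ⟨z, hz, hloss⟩ := exists_loss_ne_zero_of_mem_ex2 hB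
  obtain ⟨hBm, -, hBS, hsub, hcard⟩ := mem_ex2_unpack hB
  have h5 := card_eq_five_of_loss_ne_zero_one hs hl hG hd hk hBm (hsub hz) hloss
  have hzB : z ∉ B := (Finset.mem_sdiff.1 hz).2
  rw [Finset.card_insert_of_notMem hzB] at h5
  have := Finset.card_sdiff_add_card_eq_card hBS
  omega

open scoped Classical in
/-- With one coloop of `M|G` and two coloops of `S`, `coloops S = K ∪ {x}` with `x ∉ K`. -/
theorem exists_coloops_eq_insert_one (hS : S ∈ shadowAt M (4 + 2) 4 (Uq M (4 + 2) 4) G) (hk : kColoops M G = 1)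
    (ha : (coloops M S).card = 2) :
    ∃ x, x ∉ G.filter (fun y => y ∉ clF M (G.erase y)) ∧
      coloops M S = insert x (G.filter (fun y => y ∉ clF M (G.erase y))) := by
  set K := G.filter (fun y => y ∉ clF M (G.erase y)) with hKdef
  have hKsub : K ⊆ coloops M S := coloopsG_subset_coloops hS
  have hKc : K.card = 1 := by unfold kColoops at hk; rw [← hKdef] at hk; exact hk
  have hdiff : (coloops M S \ K).card = 1 := by
    have := Finset.card_sdiff_add_card_eq_card hKsub
    omega
  obtain ⟨x, hx⟩ := Finset.card_eq_one.1 hdiff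
  have hxmem : x ∈ coloops M S \ K := by rw [hx]; exact Finset.mem_singleton_self x
  refine ⟨x, (Finset.mem_sdiff.1 hxmem).2, ?_⟩
  ext e
  constructor
  · intro he
    rw [Finset.mem_insert]
    by_cases heK : e ∈ K
    · exact Or.inr heK
    · left
      have : e ∈ coloops M S \ K := Finset.mem_sdiff.2 ⟨he, heK⟩
      rw [hx, Finset.mem_singleton] at this
      exact this
  · intro he
    rw [Finset.mem_insert] at he
    rcases he with rfl | heK
    · exact (Finset.mem_sdiff.1 hxmem).1
    · exact hKsub heK

open scoped Classical in
/-- **The quadrangle property** for any far set of six elements: a set `B ⊇ coloops S` with `B ⊆ S`, `|S ∖ B| = 2` and `ρ(B) ≤ 4`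
has both points of `S ∖ B` outside `cl B`. -/
theorem not_mem_clF_of_pair' (hG : G ∈ flatsQ M (4 + 1)) (hS : S ∈ shadowAt M (4 + 2) 4 (Uq M (4 + 2) 4) G)
    (hS6 : S.card = 6) {B : Finset α} (hcolB : coloops M S ⊆ B) (hBS : B ⊆ S) (hcard : (S \ B).card = 2)
    (hrB : rkN M B ≤ 4) {u : α} (hu : u ∈ S \ B) : u ∉ clF M B := by
  intro hucl
  obtain ⟨a, b, hab, hP⟩ := Finset.card_eq_two.1 hcard
  have hSg : S ⊆ gr M := (subset_of_mem_shadowAt hS).trans (mem_flatsQ.1 hG).1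
  have hu' : ∃ u', u' ≠ u ∧ S \ B = {u, u'} := by
    rw [hP, Finset.mem_insert, Finset.mem_singleton] at hu
    rcases hu with rfl | rfl
    · exact ⟨b, hab.symm, hP⟩
    · exact ⟨a, hab, by rw [hP, Finset.pair_comm]⟩
  obtain ⟨u', hu'u, hP'⟩ := hu'
  have hu'S : u' ∈ S \ B := by rw [hP']; exact Finset.mem_insert_of_mem (Finset.mem_singleton_self _)
  have hu'c : u' ∉ coloops M S := fun h => (Finset.mem_sdiff.1 hu'S).2 (hcolB h)
  have hI : M.Indep ((S.erase u' : Finset α) : Set α) :=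
    indep_erase_of_not_coloop hG hS hS6 (Finset.mem_sdiff.1 hu'S).1 hu'c
  have hr5 : rkN M (S.erase u') = 5 := by
    rw [rkN_eq_card_of_indep hI, Finset.card_erase_of_mem (Finset.mem_sdiff.1 hu'S).1, hS6]
  have hsub : S.erase u' ⊆ clF M B := by
    rw [erase_eq_insert_of_sdiff_pair hBS hP' (Ne.symm hu'u)]
    exact Finset.insert_subset hucl (subset_clF_of_subset_gr (hBS.trans hSg))
  have h1 := rkN_mono (M := M) hsub
  rw [rkN_clF, hr5] at h1
  omega

open scoped Classical in
/-- Requests of a pair member (`coloops S ⊆ B ⊆ S`, `|S ∖ B| = 2`): `≤ 6/25`; `≤ 1/5` and `|G ∖ cl B| ≥ 3` unless fat. -/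
theorem req_pair_le' (hG : G ∈ flatsQ M (4 + 1)) (hd : (gr M \ G).card = 3)
    (hS : S ∈ shadowAt M (4 + 2) 4 (Uq M (4 + 2) 4) G) (hS6 : S.card = 6) {B : Finset α}
    (hBm : B ∈ membersIn M (Uq M (4 + 2) 4) G) (hcolB : coloops M S ⊆ B) (hBS : B ⊆ S) (hcard : (S \ B).card = 2) :
    req M 4 B ≤ 6 / 25 ∧ (¬ (G \ S ⊆ clF M B) → req M 4 B ≤ 1 / 5) ∧ 2 ≤ (G \ clF M B).card ∧
      (¬ (G \ S ⊆ clF M B) → 3 ≤ (G \ clF M B).card) := by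
  have hSG : S ⊆ G := subset_of_mem_shadowAt hS
  have hBU : B ∈ Uq M (4 + 2) 4 := (mem_membersIn.1 hBm).1
  have hrB : rkN M B ≤ 4 := by
    have h := (mem_Uq.1 hBU).2.1
    rw [eRk_eq_rkN] at h
    have : rkN M B = 4 := by exact_mod_cast h
    omega
  have hsub : S \ B ⊆ G \ clF M B := fun u hu =>
    Finset.mem_sdiff.2 ⟨hSG (Finset.mem_sdiff.1 hu).1, not_mem_clF_of_pair' hG hS hS6 hcolB hBS hcard hrB hu⟩
  have h2 : 2 ≤ (G \ clF M B).card := hcard ▸ Finset.card_le_card hsub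
  have h3 : ¬ (G \ S ⊆ clF M B) → 3 ≤ (G \ clF M B).card := by
    intro hnot
    rw [Finset.not_subset] at hnot
    obtain ⟨p, hpP, hpcl⟩ := hnot
    have hsub' : insert p (S \ B) ⊆ G \ clF M B :=
      Finset.insert_subset (Finset.mem_sdiff.2 ⟨(Finset.mem_sdiff.1 hpP).1, hpcl⟩) hsub
    have := Finset.card_le_card hsub'
    rw [Finset.card_insert_of_notMem (fun h => (Finset.mem_sdiff.1 hpP).2 (Finset.mem_sdiff.1 h).1), hcard] at this
    exact this
  refine ⟨?_, ?_, h2, h3⟩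
  · have := req_le_of_le_card hG hd (mem_membersIn.1 hBm).2 h2
    norm_num at this
    exact this
  · intro hnot
    have := req_le_of_le_card hG hd (mem_membersIn.1 hBm).2 (h3 hnot)
    norm_num at this
    exact this

end TwoOneA

end PercRepro.Shadow
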